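import Summits.CriticalPhenomena.Ising3DConformalLimit.Theses.PerfectScreening
import Summits.CriticalPhenomena.Ising3DConformalLimit.Theorems.PrecisionLaplacianDirectCorrelationStableTailClosureModuloStableScaling
import Summits.CriticalPhenomena.Ising3DConformalLimit.Theorems.PrecisionLaplacianPrecisionIsLaplacian
import Summits.CriticalPhenomena.Ising3DConformalLimit.Theorems.PrecisionLaplacianDirectCorrelationStableTailDirichletPrinciple
import Summits.CriticalPhenomena.Ising3DConformalLimit.Theorems.PrecisionLaplacianDirectCorrelationStableTailDirichletFormTent
import Summits.CriticalPhenomena.Ising3DConformalLimit.Theorems.PrecisionLaplacianDirectCorrelationStableTailSusceptibilityLowerOfDirichlet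
import Summits.CriticalPhenomena.Ising3DConformalLimit.Theorems.PrecisionLaplacianDirectCorrelationStableTailAxisDipSusceptibilityUpper
import Summits.CriticalPhenomena.Ising3DConformalLimit.Theorems.PrecisionLaplacianDirectCorrelationStableTailConeTailMassOfStableTail
import Summits.CriticalPhenomena.Ising3DConformalLimit.Theorems.PrecisionLaplacianDirectCorrelationStableTailBoxCapture
import Summits.CriticalPhenomena.Ising3DConformalLimit.Theorems.PrecisionLaplacianDirectCorrelationStableTailNonSaturationOfHeavyTail
import HarnessLib

/-!
# Crux `PrecisionLaplacian.DirectCorrelationStableTail` (stmt-CriticalPhenomena-4799) — line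
# `diffusive-branch-is-nonsaturation`: the branch decision IS item 1342 (glue of lead c3, 2026-08-16)

Pure theorem file (no definitions; the crux's objects are written out: `H` = every finite critical kernel matrix
`G_A = (⟨σ_pσ_q⟩_{β_c(3)})` is a symmetric potential; `a(x) = inf_{A ∋ 0,x} −(G_A)⁻¹(0,x)` the direct correlation
function; `G = criticalTwoPoint 3`).  With the seven landed stubs of the line (p127266 Dirichlet principle, p127440
Dirichlet form of the tent, p127270 susceptibility lower bound, p127319 axis-dip susceptibility cap, p127487 cone tail
mass of a stable tail, p127376 box capture, p127559 non-saturation from a heavy tail), the proved support item 4803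
(`PrecisionIsLaplacian_proof`: `a ∈ ℓ¹`, `Σ a = 0`, `a ≥ 0` off `0`, `a ∗ G = −δ₀`) and the landed closure of line
self-energy-pick-inversion (p126257, `stub_closureModuloStableScaling`: stable Lévy scaling ⇒ crux), this file proves:

* `stub_infiniteVarianceOfNonSaturation` (S1): `H → NonSaturation(1342) → Σ_x a(x)|x|₂² = ∞` — non-saturation of the
  infrared bound along the axis forces the OZ step law to be SUPERDIFFUSIVE (the `η(3) > 0` half of the crux, factored
  through the filed item 1342 of route PerfectScreening);
* `stub_nonSaturationOfStableTail` (D1): `H → crux → NonSaturation(1342)` — the transfer target is NECESSARY;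
* `stub_closureModuloResidualCore`: `NonSaturation → (H → Σ a|x|² = ∞ → stable Lévy scaling) → crux` — the crux is closed
  modulo item 1342 and the RESIDUAL CORE (pure-power, angularly regular attraction to a 3-d stable law GIVEN
  superdiffusivity; registered stub `stub_stableScalingOfInfiniteVariance`, open);
* `directCorrelationStableTail_iff_branch_and_residualCore`: the exact split
  `crux ↔ (H → NonSaturation) ∧ (H → Σ a|x|² = ∞ → stable Lévy scaling)`.
-/

noncomputable section

namespace Summit.CriticalPhenomena.Ising3DConformalLimit.Cruxes.DirectCorrelationStableTail.DiffusiveBranchIsNonsaturation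

open MeasureTheory Filter Topology
open scoped BigOperators
open Literature.Probability.LatticeModels
open Summit.CriticalPhenomena.Ising3DConformalLimit.Theses

/-- Under `H`, the diagonal inverse entries `(G_A)⁻¹(0,0)` of the critical kernel are uniformly bounded (finite energy:
`pil_rD` at the level `s` of `pil_exists_s`, tree file `PrecisionLaplacianPrecisionIsLaplacian`). [folklore] -/
theorem inv_diag_bounded_of_symmPotential
    (hH : (∀ A : Finset (Site 3), (Matrix.of fun (p q : ↥A) => criticalTwoPoint 3 (q.1 - p.1)).PosDef ∧ ∀ u v : ↥A,
      (u ≠ v → (Matrix.of fun (p q : ↥A) => criticalTwoPoint 3 (q.1 - p.1))⁻¹ u v ≤ 0) ∧ 0 ≤ ∑ w, (Matrix.of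
      fun (p q : ↥A) => criticalTwoPoint 3 (q.1 - p.1))⁻¹ u w)) :
    ∃ C : ℝ, ∀ (A : Finset (Site 3)) (h0 : (0 : Site 3) ∈ A),
      (Matrix.of fun (p q : ↥A) => criticalTwoPoint 3 (q.1 - p.1))⁻¹ ⟨0, h0⟩ ⟨0, h0⟩ ≤ C := by
  classical
  have hGlim : Tendsto (criticalTwoPoint 3) cofinite (𝓝 0) := criticalTwoPoint_tendsto_zero_cofinite
  have hGsym : ∀ x, criticalTwoPoint 3 (-x) = criticalTwoPoint 3 x := fun x => criticalTwoPoint_neg x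
  have hG00 : 0 < criticalTwoPoint 3 0 := by rw [criticalTwoPoint_zero']; exact one_pos
  set r : Finset (Site 3) → Site 3 → ℝ := fun A y =>
    if h : (0 : Site 3) ∈ A ∧ y ∈ A then
      (Matrix.of fun p q : ↥A => criticalTwoPoint 3 (q.1 - p.1))⁻¹ ⟨0, h.1⟩ ⟨y, h.2⟩ else 0 with hrdef
  have hr : ∀ A y, r A y = if h : (0 : Site 3) ∈ A ∧ y ∈ A then
      (Matrix.of fun p q : ↥A => criticalTwoPoint 3 (q.1 - p.1))⁻¹ ⟨0, h.1⟩ ⟨y, h.2⟩ else 0 := fun A y => rfl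
  obtain ⟨s, hs0, hsG, hs⟩ := Summit.CriticalPhenomena.Ising3DConformalLimit.Theorems.pil_exists_s hGlim hG00
    (fun w hw => Summit.CriticalPhenomena.Ising3DConformalLimit.Theorems.pil_G_lt hH hGsym hw)
  refine ⟨1 / (criticalTwoPoint 3 0 - s), fun A h0 => ?_⟩
  have h := Summit.CriticalPhenomena.Ising3DConformalLimit.Theorems.pil_rD hH hr hs0 hs hsG A h0
  rwa [hr, dif_pos ⟨h0, h0⟩] at h

/-- **S1, abstract form.**  If `a ∈ ℓ¹(ℤ³)` with `Σ a = 0`, `a ≥ 0` off `0`, the Dirichlet inequality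
`2⟨f,h⟩_S ≤ ⟨f, G f⟩_S + Σ_{x,y∈S} h(x)h(y)(−a(y−x))` holds for `G = criticalTwoPoint 3` and all finite `S`, `f`, `h ≥ 0`,
and the infrared bound is not saturated along the axis (NonSaturation), then `Σ_x a(x)|x|₂² = ∞`: otherwise the tent
(p127440) and the Dirichlet principle give `χ_{2R} ≥ cR²` (p127270) for all `R`, while an axis dip `n G(n e₁) < ε`
caps `χ_{2Mn} ≤ C n² + 216 M³n²ε` (p127319); `M` large and `ε = 1/(216M³)` contradict. [folklore] -/
theorem not_summable_sq_of_dirichlet_of_nonSaturation (a : Site 3 → ℝ) (hsum : Summable a)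
    (hzero : (∑' y, a y) = 0) (hnn : ∀ y, y ≠ 0 → 0 ≤ a y)
    (hDP : ∀ (S : Finset (Site 3)) (f h : Site 3 → ℝ), (∀ x, 0 ≤ h x) →
      2 * ∑ x ∈ S, f x * h x ≤ (∑ x ∈ S, ∑ y ∈ S, f x * f y * criticalTwoPoint 3 (y - x)) +
        ∑ x ∈ S, ∑ y ∈ S, h x * h y * -(a (y - x)))
    (hNS : PerfectScreening.NonSaturation) :
    ¬ Summable (fun x : Site 3 => a x * ∑ j, ((x j : ℝ)) ^ 2) := by
  intro hfin
  -- finite variance in the sup norm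
  have hsq : ∀ x : Site 3, ‖x‖ ^ 2 ≤ ∑ j, ((x j : ℝ)) ^ 2 := by
    intro x
    obtain ⟨i, hi⟩ : ∃ i : Fin 3, ‖x‖ = |((x i : ℤ) : ℝ)| := by
      obtain ⟨i, -, hi⟩ := Finset.exists_mem_eq_sup (Finset.univ : Finset (Fin 3)) ⟨0, Finset.mem_univ _⟩
        fun j => ‖x j‖₊
      refine ⟨i, ?_⟩
      rw [Pi.norm_def, hi, coe_nnnorm, Int.norm_eq_abs]
    rw [hi, sq_abs]
    exact Finset.single_le_sum (f := fun j => ((x j : ℤ) : ℝ) ^ 2) (fun j _ => sq_nonneg _) (Finset.mem_univ i)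
  have hfin' : Summable (fun x : Site 3 => a x * ‖x‖ ^ 2) := by
    refine Summable.of_nonneg_of_le (fun x => ?_) (fun x => ?_) hfin
    · by_cases hx : x = 0
      · simp [hx]
      · exact mul_nonneg (hnn x hx) (sq_nonneg _)
    · by_cases hx : x = 0
      · simp [hx]
      · exact mul_le_mul_of_nonneg_left (hsq x) (hnn x hx)
  -- stubs 1–3: susceptibility lower bound
  set σ : ℝ := 27 * ∑' y : Site 3, a y * ‖y‖ ^ 2 with hσ
  have hσ0 : 0 ≤ σ := by
    refine mul_nonneg (by norm_num) (tsum_nonneg fun x => ?_)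
    by_cases hx : x = 0
    · simp [hx]
    · exact mul_nonneg (hnn x hx) (sq_nonneg _)
  have hTent : ∀ R : ℕ, 1 ≤ R → ∑ x ∈ box 3 R, ∑ y ∈ box 3 R,
      max 0 (1 - ‖x‖ / (R : ℝ)) * max 0 (1 - ‖y‖ / (R : ℝ)) * -(a (y - x)) ≤ σ * R := by
    intro R hR
    have h := stub_dirichletFormTent a hsum hzero hnn hfin' R hR
    rw [hσ]
    linarith
  obtain ⟨c, hc, hlow⟩ := stub_susceptibilityLowerOfDirichlet (criticalTwoPoint 3) (fun z => -(a z)) σ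
    (fun x => criticalTwoPoint_nonneg' x) hσ0 hDP hTent
  -- stub 4 and NonSat
  obtain ⟨C, hC⟩ := stub_axisDipSusceptibilityUpper
  -- choose M with c M² > C + 1, then ε = 1/(216 M³)
  obtain ⟨M, hM⟩ : ∃ M : ℕ, C + 1 < c * (M : ℝ) ^ 2 ∧ 1 ≤ M := by
    obtain ⟨M, hM⟩ := exists_nat_gt (max 1 ((C + 1) / c))
    have hM1 : (1 : ℝ) < M := lt_of_le_of_lt (le_max_left _ _) hM
    have hM2 : (C + 1) / c < M := lt_of_le_of_lt (le_max_right _ _) hM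
    refine ⟨M, ?_, by exact_mod_cast hM1.le⟩
    have h1 : C + 1 < c * M := by rwa [div_lt_iff₀' hc] at hM2
    have h2 : c * (M : ℝ) ≤ c * (M : ℝ) ^ 2 := by
      have : (M : ℝ) ≤ (M : ℝ) ^ 2 := by nlinarith
      exact mul_le_mul_of_nonneg_left this hc.le
    linarith
  set ε : ℝ := 1 / (216 * (M : ℝ) ^ 3) with hε
  have hMpos : (0 : ℝ) < M := by exact_mod_cast hM.2
  have hεpos : 0 < ε := by rw [hε]; positivity
  have hNS' : ∃ᶠ n : ℕ in atTop, (n : ℝ) * criticalTwoPoint 3 (Pi.single 0 (n : ℤ)) < ε := hNS ε hεpos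
  obtain ⟨n, hn, hn1⟩ := (hNS'.and_eventually (eventually_ge_atTop 1)).exists
  have hn0 : (0 : ℝ) < n := by exact_mod_cast hn1
  -- upper bound at radius 2Mn, lower bound at R = Mn
  have hup := hC ε n (2 * M) hn1 (by omega) hn
  have hlo := hlow (M * n) (Nat.one_le_iff_ne_zero.mpr (Nat.mul_ne_zero (by omega) (by omega)))
  have heq : box 3 (2 * (M * n)) = box 3 (2 * M * n) := congrArg (box 3) (Nat.mul_assoc 2 M n).symm
  rw [heq] at hlo
  have hup' : ∑ w ∈ box 3 (2 * M * n), criticalTwoPoint 3 w ≤ C * (n : ℝ) ^ 2 + 216 * (M : ℝ) ^ 3 * (n : ℝ) ^ 2 * ε := by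
    have h216 : (27 : ℝ) * ((2 * M : ℕ) : ℝ) ^ 3 = 216 * (M : ℝ) ^ 3 := by push_cast; ring
    calc ∑ w ∈ box 3 (2 * M * n), criticalTwoPoint 3 w
        ≤ C * (n : ℝ) ^ 2 + 27 * ((2 * M : ℕ) : ℝ) ^ 3 * (n : ℝ) ^ 2 * ε := hup
      _ = C * (n : ℝ) ^ 2 + 216 * (M : ℝ) ^ 3 * (n : ℝ) ^ 2 * ε := by rw [← h216]
  have hεM : 216 * (M : ℝ) ^ 3 * ε = 1 := by
    rw [hε]; field_simp
  have hkey : c * ((M : ℝ) * n) ^ 2 ≤ C * (n : ℝ) ^ 2 + (n : ℝ) ^ 2 := by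
    have h1 : c * (((M * n : ℕ) : ℝ)) ^ 2 ≤ C * (n : ℝ) ^ 2 + 216 * (M : ℝ) ^ 3 * (n : ℝ) ^ 2 * ε :=
      hlo.trans hup'
    have h2 : 216 * (M : ℝ) ^ 3 * (n : ℝ) ^ 2 * ε = (n : ℝ) ^ 2 := by
      calc 216 * (M : ℝ) ^ 3 * (n : ℝ) ^ 2 * ε = (216 * (M : ℝ) ^ 3 * ε) * (n : ℝ) ^ 2 := by ring
        _ = (n : ℝ) ^ 2 := by rw [hεM, one_mul]
    push_cast at h1
    linarith
  have hn2 : (0 : ℝ) < (n : ℝ) ^ 2 := by positivity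
  have : c * (M : ℝ) ^ 2 ≤ C + 1 := by
    have h := hkey
    rw [mul_pow] at h
    have h' : (c * (M : ℝ) ^ 2) * (n : ℝ) ^ 2 ≤ (C + 1) * (n : ℝ) ^ 2 := by linarith
    exact le_of_mul_le_mul_right h' hn2
  linarith [hM.1]


/-- **S1 `stub_infiniteVarianceOfNonSaturation` (the branch lever of the line).**  Under `H`, non-saturation of the
infrared bound along the axis (item 1342 `PerfectScreening.NonSaturation`, by name) forces the critical direct
correlation function to have INFINITE SECOND MOMENT, `Σ_x a(x)|x|₂² = ∞` (the OZ flight is superdiffusive): `L` from the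
proved item 4803, the Dirichlet principle p127266 with the finite-energy bound, and the abstract S1 above. [folklore] -/
theorem stub_infiniteVarianceOfNonSaturation :
    (∀ A : Finset (Site 3), (Matrix.of fun (p q : ↥A) => criticalTwoPoint 3 (q.1 - p.1)).PosDef ∧ ∀ u v : ↥A,
      (u ≠ v → (Matrix.of fun (p q : ↥A) => criticalTwoPoint 3 (q.1 - p.1))⁻¹ u v ≤ 0) ∧ 0 ≤ ∑ w, (Matrix.of
      fun (p q : ↥A) => criticalTwoPoint 3 (q.1 - p.1))⁻¹ u w) →
    PerfectScreening.NonSaturation →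
    ¬ Summable (fun x : Site 3 => (⨅ A : {A : Finset (Site 3) // (0 : Site 3) ∈ A ∧ x ∈ A}, -((Matrix.of fun
      (p q : ↥A.1) => criticalTwoPoint 3 (q.1 - p.1))⁻¹ ⟨0, A.2.1⟩ ⟨x, A.2.2⟩)) * ∑ j, ((x j : ℝ)) ^ 2) := by
  intro hH hNS
  obtain ⟨hsum, hzero, hnn, -, -⟩ :=
    Summit.CriticalPhenomena.Ising3DConformalLimit.Theorems.PrecisionIsLaplacian_proof hH
  exact not_summable_sq_of_dirichlet_of_nonSaturation
    (fun x : Site 3 => ⨅ A : {A : Finset (Site 3) // (0 : Site 3) ∈ A ∧ x ∈ A}, -((Matrix.of fun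
      (p q : ↥A.1) => criticalTwoPoint 3 (q.1 - p.1))⁻¹ ⟨0, A.2.1⟩ ⟨x, A.2.2⟩))
    hsum hzero hnn (stub_dirichletPrinciple (criticalTwoPoint 3) hH (inv_diag_bounded_of_symmPotential hH)) hNS

/-- **D1 `stub_nonSaturationOfStableTail` (the transfer target is NECESSARY).**  Under `H`, the crux
`DirectCorrelationStableTail` implies item 1342 `PerfectScreening.NonSaturation`: the stable tail gives shell masses
`Σ_{ρ<‖y‖≤2ρ} a ≥ cρ^{−(2−η)}` (p127487), and with `L` (item 4803), box capture (p127376) and the flux argument (p127559)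
saturation `G(ne₁) ≥ ε/n` is impossible. [folklore] -/
theorem stub_nonSaturationOfStableTail :
    (∀ A : Finset (Site 3), (Matrix.of fun (p q : ↥A) => criticalTwoPoint 3 (q.1 - p.1)).PosDef ∧ ∀ u v : ↥A,
      (u ≠ v → (Matrix.of fun (p q : ↥A) => criticalTwoPoint 3 (q.1 - p.1))⁻¹ u v ≤ 0) ∧ 0 ≤ ∑ w, (Matrix.of
      fun (p q : ↥A) => criticalTwoPoint 3 (q.1 - p.1))⁻¹ u w) →
    PrecisionLaplacian.DirectCorrelationStableTail → PerfectScreening.NonSaturation := by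
  intro hH hT
  obtain ⟨η, Φ, hη0, -, hΦc, -, hΦpos, htail⟩ := hT hH
  obtain ⟨hsum, hzero, hnn, -, hconv⟩ :=
    Summit.CriticalPhenomena.Ising3DConformalLimit.Theorems.PrecisionIsLaplacian_proof hH
  obtain ⟨c, ρ₀, hc, hmass⟩ := stub_coneTailMassOfStableTail
    (fun x : Site 3 => ⨅ A : {A : Finset (Site 3) // (0 : Site 3) ∈ A ∧ x ∈ A}, -((Matrix.of fun
      (p q : ↥A.1) => criticalTwoPoint 3 (q.1 - p.1))⁻¹ ⟨0, A.2.1⟩ ⟨x, A.2.2⟩))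
    η Φ hη0 hnn hΦc hΦpos htail
  exact stub_nonSaturationOfHeavyTail
    (fun x : Site 3 => ⨅ A : {A : Finset (Site 3) // (0 : Site 3) ∈ A ∧ x ∈ A}, -((Matrix.of fun
      (p q : ↥A.1) => criticalTwoPoint 3 (q.1 - p.1))⁻¹ ⟨0, A.2.1⟩ ⟨x, A.2.2⟩))
    (2 - η) c ρ₀ hsum hzero hnn hconv stub_boxCapture (by linarith) hc hmass

/-- **`stub_closureModuloResidualCore`: the crux is closed modulo item 1342 and the residual core.**  Given
NonSaturation (item 1342, by name) and the residual core (registered stub `stub_stableScalingOfInfiniteVariance`,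
verbatim: under `H`, superdiffusivity ⇒ stable Lévy scaling of `a`), the crux follows: S1 supplies superdiffusivity and
the landed closure `SelfEnergyPickInversion.stub_closureModuloStableScaling` (p126257) concludes the crux by name.
[folklore] -/
theorem stub_closureModuloResidualCore :
    PerfectScreening.NonSaturation →
    ((∀ A : Finset (Site 3), (Matrix.of fun (p q : ↥A) => criticalTwoPoint 3 (q.1 - p.1)).PosDef ∧ ∀ u v : ↥A, (u ≠ v
      → (Matrix.of fun (p q : ↥A) => criticalTwoPoint 3 (q.1 - p.1))⁻¹ u v ≤ 0) ∧ 0 ≤ ∑ w, (Matrix.of fun (p q : ↥A)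
      => criticalTwoPoint 3 (q.1 - p.1))⁻¹ u w) → ¬ Summable (fun x : Site 3 => (⨅ A : {A : Finset (Site 3) // (0 :
      Site 3) ∈ A ∧ x ∈ A}, -((Matrix.of fun (p q : ↥A.1) => criticalTwoPoint 3 (q.1 - p.1))⁻¹ ⟨0, A.2.1⟩ ⟨x, A.2.2⟩))
      * ∑ j, ((x j : ℝ)) ^ 2) → ∃ (α : ℝ) (Φ : (Fin 3 → ℝ) → ℝ), 1 < α ∧ α < 2 ∧ ContinuousOn Φ {u | ∑ i, u i ^ 2 = 1}
      ∧ (∀ u : Fin 3 → ℝ, ∑ i, u i ^ 2 = 1 → 0 ≤ Φ u) ∧ (∃ u : Fin 3 → ℝ, ∑ i, u i ^ 2 = 1 ∧ 0 < Φ u) ∧ ∀ f : (Fin 3 →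
      ℝ) → ℝ, Continuous f → HasCompactSupport f → (0 : Fin 3 → ℝ) ∉ tsupport f → Filter.Tendsto (fun R : ℕ => (R : ℝ)
      ^ α * ∑' x : Site 3, (⨅ A : {A : Finset (Site 3) // (0 : Site 3) ∈ A ∧ x ∈ A}, -((Matrix.of fun (p q : ↥A.1) =>
      criticalTwoPoint 3 (q.1 - p.1))⁻¹ ⟨0, A.2.1⟩ ⟨x, A.2.2⟩)) * f (fun j => (x j : ℝ) / (R : ℝ))) Filter.atTop (nhds
      (∫ y : Fin 3 → ℝ, f y * (Φ (fun j => y j / Real.sqrt (∑ l, y l ^ 2)) * Real.sqrt (∑ l, y l ^ 2) ^ (-(3 + α)))))) →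
    PrecisionLaplacian.DirectCorrelationStableTail := by
  intro hNS h8
  exact SelfEnergyPickInversion.stub_closureModuloStableScaling fun hH =>
    h8 hH (stub_infiniteVarianceOfNonSaturation hH hNS)

/-- **The exact split achieved by the line.**  The crux `DirectCorrelationStableTail` is EQUIVALENT to the conjunction
of the branch decision "`H →` NonSaturation (item 1342)" and the residual core "`H →` superdiffusivity `→` stable Lévy
scaling": forward by D1 and the necessity half of p126257 (`stableLevyScalingCore_of_directCorrelationStableTail`),
backward by `stub_closureModuloResidualCore`. [folklore] -/
theorem directCorrelationStableTail_iff_branch_and_residualCore :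
    PrecisionLaplacian.DirectCorrelationStableTail ↔
    (((∀ A : Finset (Site 3), (Matrix.of fun (p q : ↥A) => criticalTwoPoint 3 (q.1 - p.1)).PosDef ∧ ∀ u v : ↥A,
      (u ≠ v → (Matrix.of fun (p q : ↥A) => criticalTwoPoint 3 (q.1 - p.1))⁻¹ u v ≤ 0) ∧ 0 ≤ ∑ w, (Matrix.of
      fun (p q : ↥A) => criticalTwoPoint 3 (q.1 - p.1))⁻¹ u w) → PerfectScreening.NonSaturation) ∧
     ((∀ A : Finset (Site 3), (Matrix.of fun (p q : ↥A) => criticalTwoPoint 3 (q.1 - p.1)).PosDef ∧ ∀ u v : ↥A, (u ≠ v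
      → (Matrix.of fun (p q : ↥A) => criticalTwoPoint 3 (q.1 - p.1))⁻¹ u v ≤ 0) ∧ 0 ≤ ∑ w, (Matrix.of fun (p q : ↥A)
      => criticalTwoPoint 3 (q.1 - p.1))⁻¹ u w) → ¬ Summable (fun x : Site 3 => (⨅ A : {A : Finset (Site 3) // (0 :
      Site 3) ∈ A ∧ x ∈ A}, -((Matrix.of fun (p q : ↥A.1) => criticalTwoPoint 3 (q.1 - p.1))⁻¹ ⟨0, A.2.1⟩ ⟨x, A.2.2⟩))
      * ∑ j, ((x j : ℝ)) ^ 2) → ∃ (α : ℝ) (Φ : (Fin 3 → ℝ) → ℝ), 1 < α ∧ α < 2 ∧ ContinuousOn Φ {u | ∑ i, u i ^ 2 = 1}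
      ∧ (∀ u : Fin 3 → ℝ, ∑ i, u i ^ 2 = 1 → 0 ≤ Φ u) ∧ (∃ u : Fin 3 → ℝ, ∑ i, u i ^ 2 = 1 ∧ 0 < Φ u) ∧ ∀ f : (Fin 3 →
      ℝ) → ℝ, Continuous f → HasCompactSupport f → (0 : Fin 3 → ℝ) ∉ tsupport f → Filter.Tendsto (fun R : ℕ => (R : ℝ)
      ^ α * ∑' x : Site 3, (⨅ A : {A : Finset (Site 3) // (0 : Site 3) ∈ A ∧ x ∈ A}, -((Matrix.of fun (p q : ↥A.1) =>
      criticalTwoPoint 3 (q.1 - p.1))⁻¹ ⟨0, A.2.1⟩ ⟨x, A.2.2⟩)) * f (fun j => (x j : ℝ) / (R : ℝ))) Filter.atTop (nhds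
      (∫ y : Fin 3 → ℝ, f y * (Φ (fun j => y j / Real.sqrt (∑ l, y l ^ 2)) * Real.sqrt (∑ l, y l ^ 2) ^ (-(3 + α))))))) := by
  constructor
  · intro hT
    exact ⟨fun hH => stub_nonSaturationOfStableTail hH hT, fun hH _ =>
      SelfEnergyPickInversion.stableLevyScalingCore_of_directCorrelationStableTail hT hH⟩
  · rintro ⟨hNS, h8⟩
    exact SelfEnergyPickInversion.stub_closureModuloStableScaling fun hH =>
      h8 hH (stub_infiniteVarianceOfNonSaturation hH (hNS hH))

end Summit.CriticalPhenomena.Ising3DConformalLimit.Cruxes.DirectCorrelationStableTail.DiffusiveBranchIsNonsaturation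

end
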